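import Summits.AnomalousDissipation.AnomalousDissipation.Theorems.SolenoidalFractalHomogenisationLagrangianStepVmodIterProp
import Summits.AnomalousDissipation.AnomalousDissipation.Theorems.SolenoidalFractalHomogenisationLagrangianStepVmodIterateCP
import HarnessLib

/-!
# K1L_D (stmt-AnomalousDissipation-27980): (V_mod) flat stage, block (fs) — THE GRID ITERATION (tool T-I) FOR A FAST CLASS DATUM, instantiated
# for the flat pair `(U, T)` of the (V_mod) clause (certifier's table §4 (fs): «(V) on coarse classes» — the slow LEAK of a fast member of a
# coarse class DECAYS on long windows)
(helper; `--supports 27980 --as helper`; prover ad-k1loc-p3 g10; the fast-datum twin of p1 g15's `VmodGen.defect_le_iterate` (`…VmodIterProp`):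
same grid `s₀ = j₀·P`, `t₁ = m₁·P` (`P = M·W.period/ν`), same one-step constants `θ, cV, cL, cS, κ` and `ρ = θ + cV + cL + 3cS + κ ≤ 1`, the
one-step tools discharged verbatim ((V) un-squared `…VmodPairV`, leak `…VmodLeakSlow`, fast content `…VmodLeakEnergy`, coarse decay); the
abstract iteration is `iterate_defect_le_of_CP` (`…VmodIterateCP`) with base case `A 0 = F 0 = ‖v‖`, `D 0 = 0`.)

`norm_fc_leak_le_iterate_fast`: for a weakly divergence-free FAST member `v` of the class pair of a coarse slow label `ℓ` (`𝓕v` supported on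
`(±ℓ + nℤ³)`, `𝓕v(±ℓ) = 0`), on the `j`-th grid window `t ∈ [s₀ + j·t₁, s₀ + (j+1)·t₁] ∩ [0, Tw]`:

  `‖𝓕(U(s₀,t)v)(ℓ)‖ ≤ (cV + cL)·(j+1)·ρ^(j−1)·‖v‖`

(the carrier-free `T` keeps `𝓕(T v)(ℓ) = 0`, so the defect of the abstract iteration is the leak).  This is the `hleak` input
(`ε_ℓ = (cV+cL)(j+1)ρ^(j−1)`, geometric in `j`) of `VmodFlat.abs_inner_sub_le_sqrt_of_fast_modewise` on coarse classes for long windows.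
`sorry`-free; NOT a proof of (fs), of the stub, of K1L_D or of AD; rung F-D1.A0.
-/

set_option linter.dupNamespace false

noncomputable section

namespace Summit.AnomalousDissipation.AnomalousDissipation.Theorems.SolenoidalFractalHomogenisation.LagrangianStep.VmodGen

open Set MeasureTheory Complex UnitAddTorus
open scoped InnerProductSpace ENNReal
open Literature.Analysis Literature.Analysis.FunctionSpaces Literature.Analysis.FunctionSpaces.Torus
open Literature.Analysis.FluidPDE Literature.Analysis.FluidPDE.Torus Literature.Analysis.FluidPDE.LatticeShear
open Summit.AnomalousDissipation.AnomalousDissipation.Theorems.SolenoidalFractalHomogenisation.LagrangianStep.Sideband (slotAmp)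
open Summit.AnomalousDissipation.AnomalousDissipation.Theorems.SolenoidalFractalHomogenisation.LagrangianStep.VmodFlat
  (fc fc_sub loT norm_sq_fcoeff_carrierFree_decay fc_propagator_eq_zero)
open Summit.AnomalousDissipation.AnomalousDissipation.Theorems.SolenoidalFractalHomogenisation.RealisedQuasiStaticCellLaw
  (isSmooth_cell isDivFree_cell memLp_top_stLift_cell)

/-! ## The instantiated iteration for a fast class datum -/

section Clause

variable {k : ℕ} {W : LatticeWord k} {M : ℝ} {hM : 0 < M} {c : ℝ}
  {Φ : ℝ → Visc4 (Fin 3) → Visc4 (Fin 3)} {lo hi Λ β σ C ν₀ K : ℝ}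
  {ν : ℝ} {n : ℕ} {𝔸 : Visc4 (Fin 3)} {Tw : ℝ} {U T : ℝ → ℝ → (V2 →L[ℝ] V2)}

set_option maxHeartbeats 3200000 in
/-- **T-I INSTANTIATED FOR A FAST CLASS DATUM** (block (fs), coarse classes, long windows): `VmodGen.defect_le_iterate` (p1 g15, `…VmodIterProp`)
verbatim, except that the datum `v` is a weakly divergence-free FAST member of the class pair of `ℓ` (`𝓕v` supported on `(±ℓ + nℤ³)`,
`𝓕v(±ℓ) = 0`), the bound is in units of `‖v‖`, and — the carrier-free `T` keeping `𝓕(T v)(ℓ) = 0` — the defect IS the slow LEAK: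
  `‖𝓕(U(s₀,t)v)(ℓ)‖ ≤ (cV + cL)·(j+1)·ρ^(j−1)·‖v‖` on the `j`-th grid window. -/
theorem norm_fc_leak_le_iterate_fast (hV : SlowVectorClauseF W M hM c Φ lo hi Λ β σ C ν₀ K) (hlo : 0 < lo) (hhi : 0 ≤ hi) (hΛ : 1 ≤ Λ)
    (hc : 0 ≤ c) (hC : 0 ≤ C)
    (hν : ν ∈ Set.Ioo 0 ν₀) (hn : 1 ≤ n) (hodd : OddSmall 𝔸 (ν * β))
    (hwin : ∃ lam ∈ Set.Icc (1:ℝ) Λ, NearIso 𝔸 (ν * (lo / lam)) (ν * (hi * lam)))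
    (hΦw : ∃ lam ∈ Set.Icc (1:ℝ) Λ, NearIso (Φ ν ((1 / ν) • 𝔸)) (lo / lam) (hi * lam))
    (hU : IsPropagator Tw (cellField W M hM ν hν.1 n) ((1 / (n:ℝ) ^ 2) • 𝔸) U)
    (hT : IsPropagator Tw (fun (_ : ℝ) (_ : UnitAddTorus (Fin 3)) => (0 : EuclideanSpace ℝ (Fin 3)))
      ((1 / (n:ℝ) ^ 2) • (𝔸 + (c / ν) • Φ ν ((1 / ν) • 𝔸))) T)
    {s₀ : ℝ} (hs₀T : s₀ < Tw) (j₀ : ℕ) (hs₀ : s₀ = j₀ * (M * W.period / ν))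
    (m₁ : ℕ) (hm₁ : 1 ≤ m₁)
    {Lb : ℕ} (hLb : 2 * Lb < n) {ℓ : Fin 3 → ℤ} (hℓ : ℓ ≠ 0) (hℓL : ℓ ∈ Torus.freqBall (d := Fin 3) Lb)
    (hscale : ‖Torus.latticeVec ℓ‖ * (⌈K / ν⌉₊ : ℝ) ≤ n)
    (v : V2) (hv : v ∈ divFreeL2 (Fin 3))
    (hvcl : ∀ k', fc v k' ≠ 0 → (∀ i, (n : ℤ) ∣ k' i - ℓ i) ∨ (∀ i, (n : ℤ) ∣ k' i + ℓ i))
    (hv1 : fc v ℓ = 0) (hv2 : fc v (-ℓ) = 0)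
    {θ cV cL cS κ : ℝ}
    (hθ : θ = Real.exp (-(4 * Real.pi ^ 2 * loT lo Λ c ν n * Torus.freqNormSq ℓ * (m₁ * (M * W.period / ν)))))
    (hcV : cV = 2 * Real.sqrt 2 * (C * (C * (ν ^ σ + (‖Torus.latticeVec ℓ‖ * (⌈K / ν⌉₊ : ℝ) / n) ^ σ)
        + (8 * Real.pi ^ 2 * ‖Torus.latticeVec ℓ‖ ^ 2 * (hi * Λ) * (ν + c / ν) / (n:ℝ) ^ 2) * (M * W.period / ν))))
    (hcL : cL = (12 * k * (Real.sqrt (freqNormSq ℓ) / n) / (Real.pi ^ 2 * (ν * (lo / Λ)))) *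
        Real.exp (18 * (k : ℝ) ^ 2 * (freqNormSq ℓ / (n : ℝ) ^ 2) * (m₁ * (M * W.period / ν)) / (Real.pi ^ 2 * (ν * (lo / Λ)))))
    (hcS : cS = 8 * (Real.sqrt (freqNormSq ℓ) / n) * (∑ j, ‖slotAmp W j‖) / (Real.pi * (ν * (lo / Λ))))
    (hκ : κ = Real.exp (-(Real.pi ^ 2 * (ν * (lo / Λ)) / 2 * (m₁ * (M * W.period / ν)))))
    (hρ1 : θ + cV + cL + 3 * cS + κ ≤ 1) :
    ∀ j : ℕ, ∀ t, s₀ + j * (m₁ * (M * W.period / ν)) ≤ t → t ≤ s₀ + (j + 1) * (m₁ * (M * W.period / ν)) → t ≤ Tw →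
      ‖fc (U s₀ t v) ℓ‖ ≤ (cV + cL) * ((j : ℝ) + 1) * (θ + cV + cL + 3 * cS + κ) ^ (j - 1) * ‖v‖ := by
  classical
  -- ### scalars
  set P : ℝ := M * W.period / ν with hP
  set t₁ : ℝ := m₁ * P with ht₁
  have hWp := PermissibleCarrier.period_pos W
  have hP0 : 0 < P := by rw [hP]; exact div_pos (mul_pos hM hWp) hν.1
  have hm₁0 : (0:ℝ) < m₁ := by exact_mod_cast (lt_of_lt_of_le zero_lt_one hm₁)
  have ht₁0 : 0 < t₁ := mul_pos hm₁0 hP0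
  have hs₀0 : 0 ≤ s₀ := by rw [hs₀]; exact mul_nonneg (Nat.cast_nonneg _) hP0.le
  have hnpos : 0 < n := hn
  have hn0 : (0:ℝ) < n := by exact_mod_cast hnpos
  have hn1 : n ≠ 0 := Nat.pos_iff_ne_zero.1 hnpos
  have hn2 : (0:ℝ) < 1 / (n:ℝ) ^ 2 := by positivity
  have hΛ0 : 0 < Λ := lt_of_lt_of_le one_pos hΛ
  have hcν : 0 ≤ c / ν := div_nonneg hc hν.1.le
  have hloA : 0 < ν * (lo / Λ) := mul_pos hν.1 (div_pos hlo hΛ0)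
  -- `2|ℓ| < n` from the ball
  have hℓn : 2 * Real.sqrt (freqNormSq ℓ) < n := by
    have h2 := hℓL
    rw [Torus.mem_freqBall] at h2
    have hsq : Real.sqrt (freqNormSq ℓ) ≤ Lb := by
      rw [← Real.sqrt_sq (Nat.cast_nonneg Lb)]; exact Real.sqrt_le_sqrt h2
    have : (2:ℝ) * Lb < n := by exact_mod_cast hLb
    linarith
  -- ### windows of the two tensors
  have hAΛ : NearIso 𝔸 (ν * (lo / Λ)) (ν * (hi * Λ)) := by
    obtain ⟨lam, hlam, hA⟩ := hwin
    have hlam1 : 0 < lam := lt_of_lt_of_le one_pos hlam.1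
    exact hA.mono (mul_le_mul_of_nonneg_left (div_le_div_of_nonneg_left hlo.le hlam1 hlam.2) hν.1.le)
      (mul_le_mul_of_nonneg_left (mul_le_mul_of_nonneg_left hlam.2 hhi) hν.1.le)
  obtain ⟨lam, hlam, hA⟩ := hwin
  obtain ⟨lam', hlam', hΦn⟩ := hΦw
  have hlam0 : 0 < lam := lt_of_lt_of_le one_pos hlam.1
  have hlam'0 : 0 < lam' := lt_of_lt_of_le one_pos hlam'.1
  have hcoarse0 : NearIso ((1 / (n:ℝ) ^ 2) • (𝔸 + (c / ν) • Φ ν ((1 / ν) • 𝔸)))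
      ((1 / (n:ℝ) ^ 2) * (ν * (lo / lam) + (c / ν) * (lo / lam'))) ((1 / (n:ℝ) ^ 2) * (ν * (hi * lam) + (c / ν) * (hi * lam'))) :=
    (hA.add (hΦn.smul hcν)).smul hn2.le
  have hloT_le : loT lo Λ c ν n ≤ (1 / (n:ℝ) ^ 2) * (ν * (lo / lam) + (c / ν) * (lo / lam')) := by
    unfold loT
    have h1 : lo / Λ ≤ lo / lam := div_le_div_of_nonneg_left hlo.le hlam0 hlam.2
    have h2 : lo / Λ ≤ lo / lam' := div_le_div_of_nonneg_left hlo.le hlam'0 hlam'.2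
    have h3 : (ν + c / ν) * (lo / Λ) ≤ ν * (lo / lam) + (c / ν) * (lo / lam') := by
      have := mul_le_mul_of_nonneg_left h1 hν.1.le
      have := mul_le_mul_of_nonneg_left h2 hcν
      nlinarith
    exact mul_le_mul_of_nonneg_left h3 hn2.le
  have hloT : 0 < loT lo Λ c ν n := by
    unfold loT
    have hνc : 0 < ν + c / ν := by have := hν.1; positivity
    exact mul_pos hn2 (mul_pos hνc (div_pos hlo hΛ0))
  have hcoarse : NearIso ((1 / (n:ℝ) ^ 2) • (𝔸 + (c / ν) • Φ ν ((1 / ν) • 𝔸)))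
      (loT lo Λ c ν n) ((1 / (n:ℝ) ^ 2) * (ν * (hi * lam) + (c / ν) * (hi * lam'))) := hcoarse0.mono hloT_le le_rfl
  -- ### the stretched word and the grid phases
  set W₁ : LatticeWord k := (W.stretch M hM).stretch (1 / ν) (one_div_pos.mpr hν.1) with hW₁
  have hU' : IsPropagator Tw (W₁.cell n) ((1 / (n:ℝ) ^ 2) • 𝔸) U := hU
  have hgrid : ∀ j : ℕ, ∀ τ, cellField W M hM ν hν.1 n (s₀ + j * t₁ + τ) = cellField W M hM ν hν.1 n τ := by
    intro j τ
    have e : s₀ + j * t₁ = ((j₀ + j * m₁ : ℕ) : ℝ) * (M * W.period / ν) := by rw [hs₀, ht₁, hP]; push_cast; ring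
    rw [e]
    exact cellField_add_nat_mul_period W M hM ν hν.1 n (j₀ + j * m₁) τ
  have hgrid' : ∀ j : ℕ, ∀ τ, W₁.cell n (s₀ + j * t₁ + τ) = W₁.cell n τ := hgrid
  -- ### the class predicate
  set CP : V2 → Prop := fun y => ∀ k', fc y k' ≠ 0 → (∀ i, (n : ℤ) ∣ k' i - ℓ i) ∨ (∀ i, (n : ℤ) ∣ k' i + ℓ i) with hCP
  have hCPpair : ∀ a : V2, (∀ k', k' ≠ ℓ → k' ≠ -ℓ → fc a k' = 0) → CP a := by
    intro a ha k' hk'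
    by_cases h1 : k' = ℓ
    · left; intro i; rw [h1, sub_self]; exact dvd_zero _
    · by_cases h2 : k' = -ℓ
      · right; intro i; rw [h2, Pi.neg_apply, neg_add_cancel]; exact dvd_zero _
      · exact absurd (ha k' h1 h2) hk'
  have hCPoff : ∀ y f : V2, CP y → (∀ k', k' ≠ ℓ → k' ≠ -ℓ → fc f k' = fc y k') → fc f ℓ = 0 → fc f (-ℓ) = 0 → CP f := by
    intro y f hy hfoff hf1 hf2 k' hk'
    by_cases h1 : k' = ℓ
    · rw [h1] at hk'; exact absurd hf1 hk'
    · by_cases h2 : k' = -ℓ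
      · rw [h2] at hk'; exact absurd hf2 hk'
      · rw [hfoff k' h1 h2] at hk'; exact hy k' hk'
  -- class-pair preservation of the cell member
  have hbU : MemLp (FunctionSpaces.Torus.stLift (W₁.cell n)) ∞ (volume.restrict (Ioo 0 Tw ×ˢ (univ : Set (EuclideanSpace ℝ (Fin 3))))) :=
    memLp_top_stLift_cell W₁ n Tw
  have hbUdiv : ∀ᵐ τ ∂(volume.restrict (Ioo (0:ℝ) Tw)), FunctionSpaces.Torus.IsWeaklyDivFree (W₁.cell n τ) :=
    ae_of_all _ fun τ => (isDivFree_cell W₁ n τ).isWeaklyDivFree_holds (isSmooth_cell W₁ n τ)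
  have hgridsp : ∀ (jj : Fin 3 → Fin n) (τ : ℝ) (y : UnitAddTorus (Fin 3)),
      W₁.cell n τ (y + (fun i => ((((jj i : ℕ) : ℝ) / n : ℝ) : UnitAddCircle))) = W₁.cell n τ y :=
    fun jj τ y => cell_add_grid W₁ hnpos jj τ y
  have hcellN : NearIso ((1 / (n:ℝ) ^ 2) • 𝔸) ((1 / (n:ℝ) ^ 2) * (ν * (lo / Λ))) ((1 / (n:ℝ) ^ 2) * (ν * (hi * Λ))) := hAΛ.smul hn2.le
  have hcellN_lo : 0 < (1 / (n:ℝ) ^ 2) * (ν * (lo / Λ)) := by positivity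
  have hUcl : ∀ s t, 0 ≤ s → s ≤ t → t ≤ Tw → ∀ y : V2, y ∈ divFreeL2 (Fin 3) → CP y → CP (U s t y) := by
    intro s t hs hst htT y _ hy k' hk'
    by_contra hnot
    -- `y` vanishes on the class pair of `k'`, hence so does `U s t y`
    have hyv : ∀ k'', ((∀ i, (n:ℤ) ∣ k'' i - k' i) ∨ (∀ i, (n:ℤ) ∣ k'' i + k' i)) → fc y k'' = 0 := by
      intro k'' hk''
      by_contra hne0
      have hcl := hy k'' hne0
      apply hnot
      rcases hk'' with h1 | h1 <;> rcases hcl with h2 | h2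
      · left; intro i; have := dvd_sub (h2 i) (h1 i); rwa [show k'' i - ℓ i - (k'' i - k' i) = k' i - ℓ i by ring] at this
      · right; intro i; have := dvd_sub (h2 i) (h1 i); rwa [show k'' i + ℓ i - (k'' i - k' i) = k' i + ℓ i by ring] at this
      · right; intro i; have := dvd_sub (h1 i) (h2 i); rwa [show k'' i + k' i - (k'' i - ℓ i) = k' i + ℓ i by ring] at this
      · left; intro i; have := dvd_sub (h1 i) (h2 i); rwa [show k'' i + k' i - (k'' i + ℓ i) = k' i - ℓ i by ring] at this
    have h0 := PropagatorSymm.fcoeff_apply_eq_zero_of_classes hU' hcellN hcellN_lo hbU hbUdiv hnpos hgridsp k' hs hst htT y hyv k'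
      (Or.inl fun i => by rw [sub_self]; exact dvd_zero _)
    exact hk' h0
  -- ### the five one-step tools
  have hθ0 : 0 ≤ θ := by rw [hθ]; exact (Real.exp_pos _).le
  have hR'0 : 0 ≤ 8 * Real.pi ^ 2 * ‖Torus.latticeVec ℓ‖ ^ 2 * (hi * Λ) * (ν + c / ν) / (n:ℝ) ^ 2 := by
    have : 0 ≤ ν + c / ν := by have := hν.1; positivity
    positivity
  have hg0 : 0 ≤ ‖Torus.latticeVec ℓ‖ * (⌈K / ν⌉₊ : ℝ) / n := by positivity
  have hcV0 : 0 ≤ cV := by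
    rw [hcV]
    have : 0 ≤ ν ^ σ + (‖Torus.latticeVec ℓ‖ * (⌈K / ν⌉₊ : ℝ) / n) ^ σ := by
      have := Real.rpow_nonneg hν.1.le σ; have := Real.rpow_nonneg hg0 σ; positivity
    positivity
  have hcL0 : 0 ≤ cL := by rw [hcL]; positivity
  have hcS0 : 0 ≤ cS := by rw [hcS]; positivity
  have hκ0 : 0 ≤ κ := by rw [hκ]; exact (Real.exp_pos _).le
  -- self maps at a window start (degenerate windows)
  have hUself : ∀ s, 0 ≤ s → s ≤ Tw → ∀ y : V2, y ∈ divFreeL2 (Fin 3) → U s s y = y :=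
    fun s hs hsT y hy => hU.self_of_divFree s hs hsT y ((mem_divFreeL2_iff y).1 hy)
  have hTself : ∀ s, 0 ≤ s → s ≤ Tw → ∀ y : V2, y ∈ divFreeL2 (Fin 3) → T s s y = y :=
    fun s hs hsT y hy => hT.self_of_divFree s hs hsT y ((mem_divFreeL2_iff y).1 hy)
  have herrle : ∀ τ : ℝ, C * (C * (ν ^ σ + (‖Torus.latticeVec ℓ‖ * (⌈K / ν⌉₊ : ℝ) / n) ^ σ)
          * min 1 ((8 * Real.pi ^ 2 * ‖Torus.latticeVec ℓ‖ ^ 2 * (hi * Λ) * (ν + c / ν) / (n:ℝ) ^ 2) * τ)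
        + (8 * Real.pi ^ 2 * ‖Torus.latticeVec ℓ‖ ^ 2 * (hi * Λ) * (ν + c / ν) / (n:ℝ) ^ 2) * (M * W.period / ν))
        ≤ C * (C * (ν ^ σ + (‖Torus.latticeVec ℓ‖ * (⌈K / ν⌉₊ : ℝ) / n) ^ σ)
        + (8 * Real.pi ^ 2 * ‖Torus.latticeVec ℓ‖ ^ 2 * (hi * Λ) * (ν + c / ν) / (n:ℝ) ^ 2) * (M * W.period / ν)) := by
    intro τ
    have hX : 0 ≤ C * (ν ^ σ + (‖Torus.latticeVec ℓ‖ * (⌈K / ν⌉₊ : ℝ) / n) ^ σ) := by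
      have := Real.rpow_nonneg hν.1.le σ; have := Real.rpow_nonneg hg0 σ; positivity
    have hmin : min 1 ((8 * Real.pi ^ 2 * ‖Torus.latticeVec ℓ‖ ^ 2 * (hi * Λ) * (ν + c / ν) / (n:ℝ) ^ 2) * τ) ≤ 1 := min_le_left _ _
    have h1 := mul_le_mul_of_nonneg_left hmin hX
    rw [mul_one] at h1
    have h2 : C * (ν ^ σ + (‖Torus.latticeVec ℓ‖ * (⌈K / ν⌉₊ : ℝ) / n) ^ σ)
          * min 1 ((8 * Real.pi ^ 2 * ‖Torus.latticeVec ℓ‖ ^ 2 * (hi * Λ) * (ν + c / ν) / (n:ℝ) ^ 2) * τ)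
        + (8 * Real.pi ^ 2 * ‖Torus.latticeVec ℓ‖ ^ 2 * (hi * Λ) * (ν + c / ν) / (n:ℝ) ^ 2) * (M * W.period / ν)
        ≤ C * (ν ^ σ + (‖Torus.latticeVec ℓ‖ * (⌈K / ν⌉₊ : ℝ) / n) ^ σ)
        + (8 * Real.pi ^ 2 * ‖Torus.latticeVec ℓ‖ ^ 2 * (hi * Λ) * (ν + c / ν) / (n:ℝ) ^ 2) * (M * W.period / ν) := by linarith
    exact mul_le_mul_of_nonneg_left h2 hC
  -- (V) un-squared on one window
  have hV1 : ∀ j : ℕ, ∀ t, s₀ + j * t₁ ≤ t → t ≤ s₀ + (j + 1) * t₁ → t ≤ Tw → ∀ a : V2, a ∈ divFreeL2 (Fin 3) →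
      (∀ k', k' ≠ ℓ → k' ≠ -ℓ → fc a k' = 0) → ‖fc (U (s₀ + j * t₁) t a - T (s₀ + j * t₁) t a) ℓ‖ ≤ cV * ‖fc a ℓ‖ := by
    intro j t hjt _ htT a ha haoff
    have hsj0 : 0 ≤ s₀ + j * t₁ := by positivity
    rcases eq_or_lt_of_le (hjt.trans htT) with heq | hsjT
    · -- degenerate window `s_j = t = Tw`
      have ht : t = s₀ + j * t₁ := le_antisymm (heq ▸ htT) hjt
      rw [ht, hUself _ hsj0 heq.le a ha, hTself _ hsj0 heq.le a ha, sub_self]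
      have : fc (0 : V2) ℓ = 0 := fcoeff_zero ℓ
      rw [this, norm_zero]; exact mul_nonneg hcV0 (norm_nonneg _)
    · have key := norm_fc_sub_le_of_clauseV hV hlo hhi hΛ hc hC hν hn hodd ⟨lam, hlam, hA⟩ ⟨lam', hlam', hΦn⟩ hU hT hsj0 hsjT (hgrid j)
        hjt htT hLb hℓ hℓL hscale a ha haoff
      refine key.trans ?_
      rw [hcV]
      have h := mul_le_mul_of_nonneg_left (herrle (t - (s₀ + j * t₁))) (by positivity : (0:ℝ) ≤ 2 * Real.sqrt 2)
      have h' := mul_le_mul_of_nonneg_right h (norm_nonneg (fc a ℓ))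
      simpa only [hP, mul_assoc] using h'
  -- slow leakage of a fast class datum on one window
  have hLk : ∀ j : ℕ, ∀ t, s₀ + j * t₁ ≤ t → t ≤ s₀ + (j + 1) * t₁ → t ≤ Tw → ∀ f : V2, f ∈ divFreeL2 (Fin 3) → CP f →
      fc f ℓ = 0 → fc f (-ℓ) = 0 → ‖fc (U (s₀ + j * t₁) t f) ℓ‖ ≤ cL * ‖f‖ := by
    intro j t hjt htj htT f hf hCPf hf1 hf2
    have hsj0 : 0 ≤ s₀ + j * t₁ := by positivity
    rcases eq_or_lt_of_le (hjt.trans htT) with heq | hsjT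
    · have ht : t = s₀ + j * t₁ := le_antisymm (heq ▸ htT) hjt
      rw [ht, hUself _ hsj0 heq.le f hf, hf1, norm_zero]; exact mul_nonneg hcL0 (norm_nonneg _)
    · have key := norm_fc_slow_le_of_fast W₁ hn1 hAΛ hloA hU' hsj0 hjt htT hsjT (hgrid' j) hℓ hℓn f ((mem_divFreeL2_iff f).1 hf)
        hCPf hf1 hf2
      refine key.trans (mul_le_mul_of_nonneg_right ?_ (norm_nonneg _))
      rw [hcL]
      refine mul_le_mul_of_nonneg_left (Real.exp_le_exp.2 ?_) (by positivity)
      have hτ : t - (s₀ + j * t₁) ≤ t₁ := by linarith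
      have hnum : 0 ≤ 18 * (k : ℝ) ^ 2 * (freqNormSq ℓ / (n : ℝ) ^ 2) := by have := freqNormSq_nonneg ℓ; positivity
      have hden : 0 < Real.pi ^ 2 * (ν * (lo / Λ)) := by positivity
      rw [ht₁, hP] at hτ
      exact div_le_div_of_nonneg_right (mul_le_mul_of_nonneg_left hτ hnum) hden.le
  -- fast content after one grid step
  have hFs : ∀ j : ℕ, s₀ + (j + 1) * t₁ ≤ Tw → ∀ y : V2, y ∈ divFreeL2 (Fin 3) → CP y →
      Real.sqrt (‖U (s₀ + j * t₁) (s₀ + (j + 1) * t₁) y‖ ^ 2 -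
          (‖fc (U (s₀ + j * t₁) (s₀ + (j + 1) * t₁) y) ℓ‖ ^ 2 + ‖fc (U (s₀ + j * t₁) (s₀ + (j + 1) * t₁) y) (-ℓ)‖ ^ 2))
        ≤ cS * ‖y‖ + κ * Real.sqrt (‖y‖ ^ 2 - (‖fc y ℓ‖ ^ 2 + ‖fc y (-ℓ)‖ ^ 2)) := by
    intro j hj1 y hy hCPy
    have hsj0 : 0 ≤ s₀ + j * t₁ := by positivity
    have hjj1 : s₀ + j * t₁ ≤ s₀ + (j + 1) * t₁ := by nlinarith [ht₁0]
    have hsjT : s₀ + j * t₁ < Tw := lt_of_lt_of_le (by nlinarith [ht₁0]) hj1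
    have key := sqrt_fast_le W₁ hn1 hAΛ hloA hU' hsj0 hjj1 hj1 hsjT (hgrid' j) hℓ hℓn y ((mem_divFreeL2_iff y).1 hy) hCPy
    have e1 : s₀ + (j + 1) * t₁ - (s₀ + j * t₁) = t₁ := by ring
    rw [e1] at key
    rw [hcS, hκ, ht₁, hP]
    have hα : (∑ j, ‖slotAmp W₁ j‖) = ∑ j, ‖slotAmp W j‖ := Finset.sum_congr rfl fun j _ => rfl
    rw [hα, ht₁, hP] at key
    exact key
  -- coarse decay at the grid step, and contraction
  have hTdec : ∀ s t, 0 ≤ s → s ≤ t → t ≤ Tw → ∀ y : V2, y ∈ divFreeL2 (Fin 3) →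
      ‖fc (T s t y) ℓ‖ ≤ Real.exp (-(4 * Real.pi ^ 2 * loT lo Λ c ν n * Torus.freqNormSq ℓ * (t - s))) * ‖fc y ℓ‖ := by
    intro s t hs hst htT y hy
    rcases eq_or_lt_of_le (hst.trans htT) with heq | hsT
    · have ht : t = s := le_antisymm (heq ▸ htT) hst
      rw [ht, hTself s hs heq.le y hy, sub_self, mul_zero, neg_zero, Real.exp_zero, one_mul]
    · have h1 := norm_sq_fcoeff_carrierFree_decay hcoarse hloT hT hs hst htT hsT y ((mem_divFreeL2_iff y).1 hy) ℓ
      have h2 : Real.exp (-(8 * Real.pi ^ 2 * loT lo Λ c ν n * Torus.freqNormSq ℓ * (t - s))) * ‖fc y ℓ‖ ^ 2 =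
          (Real.exp (-(4 * Real.pi ^ 2 * loT lo Λ c ν n * Torus.freqNormSq ℓ * (t - s))) * ‖fc y ℓ‖) ^ 2 := by
        rw [mul_pow, ← Real.exp_nat_mul]; congr 2; push_cast; ring
      rw [h2] at h1
      exact (pow_le_pow_iff_left₀ (norm_nonneg _) (by positivity) two_ne_zero).1 h1
  have hTθ : ∀ j : ℕ, s₀ + (j + 1) * t₁ ≤ Tw → ∀ y : V2, y ∈ divFreeL2 (Fin 3) →
      ‖fc (T (s₀ + j * t₁) (s₀ + (j + 1) * t₁) y) ℓ‖ ≤ θ * ‖fc y ℓ‖ := by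
    intro j hj1 y hy
    have hsj0 : 0 ≤ s₀ + j * t₁ := by positivity
    have hjj1 : s₀ + j * t₁ ≤ s₀ + (j + 1) * t₁ := by nlinarith [ht₁0]
    have key := hTdec _ _ hsj0 hjj1 hj1 y hy
    have e1 : s₀ + (j + 1) * t₁ - (s₀ + j * t₁) = t₁ := by ring
    rw [e1] at key
    rw [hθ]
    exact key
  have hT1 : ∀ s t, 0 ≤ s → s ≤ t → t ≤ Tw → ∀ y : V2, y ∈ divFreeL2 (Fin 3) → ‖fc (T s t y) ℓ‖ ≤ ‖fc y ℓ‖ := by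
    intro s t hs hst htT y hy
    refine (hTdec s t hs hst htT y hy).trans ?_
    have hexp : Real.exp (-(4 * Real.pi ^ 2 * loT lo Λ c ν n * Torus.freqNormSq ℓ * (t - s))) ≤ 1 := by
      rw [Real.exp_le_one_iff]
      have := freqNormSq_nonneg ℓ; have : 0 ≤ t - s := by linarith
      have : 0 ≤ 4 * Real.pi ^ 2 * loT lo Λ c ν n * Torus.freqNormSq ℓ * (t - s) := by have := hloT.le; positivity
      linarith
    exact mul_le_of_le_one_left (norm_nonneg _) hexp
  -- ### the abstract iteration with the geometric majorants (base case: no slow amplitude, fast content `‖v‖`)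
  have hU0 : U s₀ s₀ v = v := hUself s₀ hs₀0 hs₀T.le v hv
  have hT0 : T s₀ s₀ v = v := hTself s₀ hs₀0 hs₀T.le v hv
  set a₀ : ℝ := ‖v‖ with ha₀
  have ha₀0 : 0 ≤ a₀ := norm_nonneg _
  set ρ : ℝ := θ + cV + cL + 3 * cS + κ with hρ
  have hρ0 : 0 ≤ ρ := by rw [hρ]; positivity
  have hvCP : CP v := hvcl
  have hA0 : ‖fc v ℓ‖ ≤ (fun j : ℕ => ρ ^ j * a₀) 0 := by
    show ‖fc v ℓ‖ ≤ ρ ^ 0 * a₀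
    rw [hv1, norm_zero, pow_zero, one_mul]
    exact ha₀0
  have hF0 : Real.sqrt (‖v‖ ^ 2 - (‖fc v ℓ‖ ^ 2 + ‖fc v (-ℓ)‖ ^ 2)) ≤ (fun j : ℕ => ρ ^ j * a₀) 0 := by
    show Real.sqrt (‖v‖ ^ 2 - (‖fc v ℓ‖ ^ 2 + ‖fc v (-ℓ)‖ ^ 2)) ≤ ρ ^ 0 * a₀
    rw [hv1, hv2, norm_zero, zero_pow two_ne_zero, add_zero, sub_zero, Real.sqrt_sq (norm_nonneg _), pow_zero, one_mul]
  have iter := iterate_defect_le_of_CP (U := U) (T := T) (Tw := Tw) (CP := CP) hℓ hs₀0 ht₁0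
    (fun s t r hs hst htr hrT y => hU.comp s t r hs hst htr hrT y) (fun s t r hs hst htr hrT y => hT.comp s t r hs hst htr hrT y)
    (fun s t y => (mem_divFreeL2_iff _).2 (hU.divFree s t y)) (fun s t y => (mem_divFreeL2_iff _).2 (hT.divFree s t y))
    hUcl hCPpair hCPoff hθ0 hcV0 hcL0 hcS0 hκ0 hV1 hLk hFs hTθ hT1 v hvCP hU0 hT0
    (fun j => ρ ^ j * a₀) (fun j => ρ ^ j * a₀) (fun j => (cV + cL) * j * ρ ^ (j - 1) * a₀)
    (fun j => mul_nonneg (mul_nonneg (mul_nonneg (add_nonneg hcV0 hcL0) (Nat.cast_nonneg j)) (pow_nonneg hρ0 _)) ha₀0)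
    hA0 hF0
    (fun j => geomA_rec hθ0 hcV0 hcL0 hcS0 hκ0 ha₀0 j) (fun j => geomF_rec hθ0 hcV0 hcL0 hcS0 hκ0 ha₀0 j)
    (fun j => by
      have h := geomD_rec (θ := θ) (cV := cV) (cL := cL) (cS := cS) (κ := κ) hθ0 hcV0 hcL0 hcS0 hκ0 ha₀0 j
      rw [Nat.add_sub_cancel] at h
      push_cast at h ⊢
      exact h)
  intro j t hjt htj htT
  have h := iter j t hjt htj htT
  have hw := geom_window_le hθ0 hcV0 hcL0 hcS0 hκ0 ha₀0 hρ1 j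
  -- the carrier-free `T` keeps `𝓕(T v)(ℓ) = 0`: the defect IS the leak
  have hs0t : s₀ ≤ t := le_trans (by nlinarith [ht₁0.le, (Nat.cast_nonneg j : (0:ℝ) ≤ j)]) hjt
  have hT0v : fc (T s₀ t v) ℓ = 0 := by
    have h1 := hT1 s₀ t hs₀0 hs0t htT v hv
    rw [hv1, norm_zero] at h1
    exact norm_le_zero_iff.1 h1
  rw [fc_sub, hT0v, sub_zero] at h
  exact h.trans hw

end Clause

end Summit.AnomalousDissipation.AnomalousDissipation.Theorems.SolenoidalFractalHomogenisation.LagrangianStep.VmodGen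

end
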